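import Summits.RiemannHypothesis.RiemannHypothesis.Theorems.WeilFormatCColumnKernel
import Summits.RiemannHypothesis.RiemannHypothesis.Theorems.WeilFormatCZetaTailGram
import HarnessLib

/-!
# Format C, L-C3b at every order: preliminaries for the order-`J` tail majorants (both sectors)

Route context: Fourier–Galerkin / Schur-complement certificates of Weil positivity on a window ("format C";
cell memo `run/shared/lean/pub/rh-explicit/rh-explicit-weil-10/FORMATC-DESIGN.md` §9.9; supporting
stmt-RiemannHypothesis-0098; seat rh-explicit-weil-10).  Small inputs shared by `WeilFormatCTailEvenJ` / `WeilFormatCTailOddJ`: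

* `abs_polarFactor_sub_sum_le`, `abs_oddPolarFactor_sub_sum_le` — the polar factors `c_m = 1/(1+4ω_m²)` and
  `d_m = ω_m/(1+4ω_m²)` as geometric sums in `q/m²` (`q = a²/(4π²)`), with remainders `q^{J+1}/m^{2J+2}` and
  `(a/(4π))q^J/m^{2J+1}` — this merges the rank-one polar columns into the pure-power ("B") family of the tail;
* `abs_modeF_le_far` — `|F_m| ≤ C_A := π/4 + ΛΣ + a(1+E)/(πB₃)` on the tail `m ≥ B₃`;
* `sum_Ico_one_div_pow_two_mul_le` — `Σ_{m∈Ico B₃ N} 1/(m^E)² ≤ 1/((2E−1)(B₃−1)^{2E−1})`;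
* `sum_sum_mul_gram_eq`, `sum_sum_add_ite_mul_eq`, `sum_sum_mul_add3_eq` — the bookkeeping identities turning the
  functional majorants into `xᵀU₂x` for explicit matrices.

Elementary; standard axioms; no definitions; no RH claim.
-/

set_option autoImplicit false
-- `Summit.RiemannHypothesis.RiemannHypothesis.…` is the layout-mandated namespace (summit = problem name).
set_option linter.dupNamespace false

noncomputable section

open Complex Finset Matrix
open scoped Real BigOperators ArithmeticFunction.vonMangoldt

namespace Summit.RiemannHypothesis.RiemannHypothesis.Theorems.WeilFormatC

open Literature.NumberTheory.LFunctions Literature.NumberTheory.LFunctions.Yoshida1992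
open Literature.Analysis.SpecialFunctions

variable {a : ℝ}

/-! ## The geometric expansion of the polar factors -/

section Polar

/-- `t/(1+t) = Σ_{r<J} (−1)^r t^{r+1} + (−1)^J t^{J+1}/(1+t)` for `t ≥ 0`. -/
theorem div_one_add_eq_geom_sum {t : ℝ} (ht : 0 ≤ t) (J : ℕ) :
    t / (1 + t) = (∑ r ∈ Finset.range J, (-1 : ℝ) ^ r * t ^ (r + 1)) + (-1 : ℝ) ^ J * t ^ (J + 1) / (1 + t) := by
  have h1 : (1 + t) ≠ 0 := by positivity
  induction J with
  | zero => simp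
  | succ J ih =>
    rw [Finset.sum_range_succ, ih]
    field_simp
    ring

/-- **Polar factor expansion**: for `ω ≠ 0` with `4ω² = 1/t` (`t > 0`):
`|1/(1+4ω²) − Σ_{r<J}(−1)^r t^{r+1}| ≤ t^{J+1}`. Stated directly in `t`: `|t/(1+t) − Σ| ≤ t^{J+1}`. -/
theorem abs_div_one_add_sub_geom_le {t : ℝ} (ht : 0 ≤ t) (J : ℕ) :
    |t / (1 + t) - ∑ r ∈ Finset.range J, (-1 : ℝ) ^ r * t ^ (r + 1)| ≤ t ^ (J + 1) := by
  rw [div_one_add_eq_geom_sum ht J, add_sub_cancel_left, abs_div, abs_mul, abs_pow, abs_neg, abs_one, one_pow,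
    one_mul, abs_of_nonneg (pow_nonneg ht _), abs_of_pos (by positivity : (0 : ℝ) < 1 + t)]
  exact div_le_self (pow_nonneg ht _) (by linarith)

/-- The even polar factor `c_m = 1/(1+4ω_m²)` as a geometric sum in `q/m²`, `q = a²/(4π²)` (`a > 0`, `m ≥ 1`):
`|c_m − Σ_{r<J} (−1)^r q^{r+1}/m^{2r+2}| ≤ q^{J+1}/m^{2J+2}`. -/
theorem abs_polarFactor_sub_sum_le (ha : 0 < a) {m : ℕ} (hm : 1 ≤ m) (J : ℕ) :
    |1 / (1 + 4 * freq a m ^ 2)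
        - ∑ r ∈ Finset.range J, (-1 : ℝ) ^ r * (a ^ 2 / (4 * π ^ 2)) ^ (r + 1) / (m : ℝ) ^ (2 * r + 2)|
      ≤ (a ^ 2 / (4 * π ^ 2)) ^ (J + 1) / (m : ℝ) ^ (2 * J + 2) := by
  have hm0 : (0 : ℝ) < m := by exact_mod_cast hm
  have hc : 1 / (1 + 4 * freq a m ^ 2) = (a ^ 2 / (4 * π ^ 2) / (m : ℝ) ^ 2) / (1 + a ^ 2 / (4 * π ^ 2) / (m : ℝ) ^ 2) := by
    rw [freq_natCast]
    field_simp
    ring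
  have hq : 0 ≤ a ^ 2 / (4 * π ^ 2) := by positivity
  generalize a ^ 2 / (4 * π ^ 2) = q at hc hq ⊢
  set t : ℝ := q / (m : ℝ) ^ 2 with ht
  have ht0 : 0 ≤ t := by positivity
  have hterm : ∀ r : ℕ, (-1 : ℝ) ^ r * q ^ (r + 1) / (m : ℝ) ^ (2 * r + 2) = (-1 : ℝ) ^ r * t ^ (r + 1) := by
    intro r
    rw [ht, div_pow, ← pow_mul, show 2 * (r + 1) = 2 * r + 2 by ring, mul_div_assoc]
  have hlast : q ^ (J + 1) / (m : ℝ) ^ (2 * J + 2) = t ^ (J + 1) := by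
    rw [ht, div_pow, ← pow_mul, show 2 * (J + 1) = 2 * J + 2 by ring]
  rw [hc, Finset.sum_congr rfl fun r _ ↦ hterm r, hlast]
  exact abs_div_one_add_sub_geom_le ht0 J

end Polar

/-- The odd polar factor `d_m = ω_m/(1+4ω_m²)` as a geometric sum, `q = a²/(4π²)` (`a > 0`, `m ≥ 1`):
`|d_m − Σ_{r<J} (−1)^r (a/(4π)) q^r/m^{2r+1}| ≤ (a/(4π)) q^J/m^{2J+1}`. -/
theorem abs_oddPolarFactor_sub_sum_le (ha : 0 < a) {m : ℕ} (hm : 1 ≤ m) (J : ℕ) :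
    |freq a m / (1 + 4 * freq a m ^ 2)
        - ∑ r ∈ Finset.range J, (-1 : ℝ) ^ r * (a / (4 * π)) * (a ^ 2 / (4 * π ^ 2)) ^ r / (m : ℝ) ^ (2 * r + 1)|
      ≤ a / (4 * π) * (a ^ 2 / (4 * π ^ 2)) ^ J / (m : ℝ) ^ (2 * J + 1) := by
  have hm0 : (0 : ℝ) < m := by exact_mod_cast hm
  have hω : 0 < freq a m := freq_pos ha hm
  have hc : freq a m / (1 + 4 * freq a m ^ 2)
      = freq a m * ((a ^ 2 / (4 * π ^ 2) / (m : ℝ) ^ 2) / (1 + a ^ 2 / (4 * π ^ 2) / (m : ℝ) ^ 2)) := by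
    rw [freq_natCast]
    field_simp
    ring
  have hωq : a / (4 * π) = freq a m * (a ^ 2 / (4 * π ^ 2)) / m := by
    rw [freq_natCast]
    field_simp
  have hq : 0 ≤ a ^ 2 / (4 * π ^ 2) := by positivity
  rw [hc, hωq]
  generalize a ^ 2 / (4 * π ^ 2) = q at hq ⊢
  set t : ℝ := q / (m : ℝ) ^ 2 with ht
  have ht0 : 0 ≤ t := by positivity
  have hterm : ∀ r : ℕ, (-1 : ℝ) ^ r * (freq a m * q / m) * q ^ r / (m : ℝ) ^ (2 * r + 1)
      = freq a m * ((-1 : ℝ) ^ r * t ^ (r + 1)) := by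
    intro r
    rw [ht, div_pow, ← pow_mul, show 2 * (r + 1) = (2 * r + 1) + 1 by ring, pow_succ (m : ℝ) (2 * r + 1),
      pow_succ q r]
    field_simp
  have hlast : freq a m * q / m * q ^ J / (m : ℝ) ^ (2 * J + 1) = freq a m * t ^ (J + 1) := by
    rw [ht, div_pow, ← pow_mul, show 2 * (J + 1) = (2 * J + 1) + 1 by ring, pow_succ (m : ℝ) (2 * J + 1),
      pow_succ q J]
    field_simp
  rw [Finset.sum_congr rfl fun r _ ↦ hterm r, ← Finset.mul_sum, ← mul_sub, abs_mul, abs_of_pos hω, hlast]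
  exact mul_le_mul_of_nonneg_left (abs_div_one_add_sub_geom_le ht0 J) hω.le

/-! ## Tail inputs -/

section Far

/-- `|F_m| ≤ C_A := π/4 + ΛΣ + a(1+E)/(πB₃)` on the tail `m ≥ B₃ ≥ 1`. -/
theorem abs_modeF_le_far (ha : 0 < a) {B₃ m : ℕ} (hB₃ : 1 ≤ B₃) (hm : B₃ ≤ m) :
    |(Complex.digamma (1 / 4 + ((freq a m : ℝ) : ℂ) / 2 * I)).im / 2
        + (∑ k ∈ weilPrimeIndex a, (Λ k : ℝ) / Real.sqrt k * Real.sin (freq a m * Real.log k)) - archExpSumSin a m|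
      ≤ π / 4 + (∑ k ∈ weilPrimeIndex a, (Λ k : ℝ) / Real.sqrt k)
        + a * (1 + weilArchDensity (2 * a)) / (π * B₃) := by
  have hm1 : 1 ≤ m := le_trans hB₃ hm
  have hm0 : (0 : ℝ) < m := by exact_mod_cast hm1
  have hB0 : (0 : ℝ) < B₃ := by exact_mod_cast hB₃
  have hBm : (B₃ : ℝ) ≤ m := by exact_mod_cast hm
  have hE0 : 0 < weilArchDensity (2 * a) := weilArchDensity_pos (by positivity)
  have hY := abs_im_digamma_freq_sub_le ha hm1
  have hT0 := archExpSumSin_nonneg ha hm1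
  have hT := archExpSumSin_le ha hm1
  have hP : |∑ k ∈ weilPrimeIndex a, (Λ k : ℝ) / Real.sqrt k * Real.sin (freq a m * Real.log k)|
      ≤ ∑ k ∈ weilPrimeIndex a, (Λ k : ℝ) / Real.sqrt k := by
    refine (Finset.abs_sum_le_sum_abs _ _).trans (Finset.sum_le_sum fun k _ ↦ ?_)
    have hw : 0 ≤ (Λ k : ℝ) / Real.sqrt k := div_nonneg ArithmeticFunction.vonMangoldt_nonneg (Real.sqrt_nonneg _)
    rw [abs_mul, abs_of_nonneg hw]
    exact (mul_le_mul_of_nonneg_left (Real.abs_sin_le_one _) hw).trans (le_of_eq (mul_one _))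
  have h1 : a / (π * m) ≤ a / (π * B₃) := by
    apply div_le_div_of_nonneg_left ha.le (by positivity)
    nlinarith [Real.pi_pos]
  have h2 : weilArchDensity (2 * a) * a / (π * m) ≤ weilArchDensity (2 * a) * a / (π * B₃) := by
    apply div_le_div_of_nonneg_left (by positivity) (by positivity)
    nlinarith [Real.pi_pos]
  have e2 : 2 * a / (π * (m : ℝ)) = 2 * (a / (π * m)) := by ring
  rw [e2] at hY
  have hsplit : a * (1 + weilArchDensity (2 * a)) / (π * B₃)
      = a / (π * B₃) + weilArchDensity (2 * a) * a / (π * B₃) := by ring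
  rw [hsplit]
  generalize (Complex.digamma (1 / 4 + ((freq a m : ℝ) : ℂ) / 2 * I)).im = Y at hY ⊢
  generalize (∑ k ∈ weilPrimeIndex a, (Λ k : ℝ) / Real.sqrt k * Real.sin (freq a m * Real.log k)) = P at hP ⊢
  generalize (∑ k ∈ weilPrimeIndex a, (Λ k : ℝ) / Real.sqrt k) = L at hP ⊢
  generalize archExpSumSin a m = T at hT0 hT ⊢
  generalize weilArchDensity (2 * a) * a / (π * m) = U at hT h2
  generalize weilArchDensity (2 * a) * a / (π * B₃) = U' at h2 ⊢
  generalize a / (π * m) = A at hY h1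
  generalize a / (π * B₃) = A' at h1 ⊢
  rw [abs_le] at hY hP ⊢
  constructor
  · linarith [hY.1, hP.1, hT, h2, h1, Real.pi_pos]
  · linarith [hY.2, hP.2, hT0, h1, h2, hT]

/-- `Σ_{m∈Ico B₃ N} 1/m^{2E} ≤ 1/((2E−1)(B₃−1)^{2E−1})` for `1 ≤ E`, `2 ≤ B₃`. -/
theorem sum_Ico_one_div_pow_two_mul_le {E B₃ : ℕ} (hE : 1 ≤ E) (hB₃ : 2 ≤ B₃) (N : ℕ) :
    ∑ m ∈ Finset.Ico B₃ N, 1 / ((m : ℝ) ^ E) ^ 2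
      ≤ 1 / ((2 * E - 1 : ℕ) * (((B₃ - 1 : ℕ) : ℝ)) ^ (2 * E - 1)) := by
  have h := sum_Ico_sq_sum_div_pow_le_gram (D := 1) (fun _ ↦ E) (fun _ ↦ hE) (by omega : 1 ≤ B₃) N (fun _ ↦ 1)
  simp only [Finset.univ_unique, Fin.default_eq_zero, Finset.sum_singleton, one_mul] at h
  have h2 := tsum_one_div_add_pow_le (e := E + E) (by omega) hB₃
  have hEE : E + E - 1 = 2 * E - 1 := by omega
  rw [hEE] at h2
  have hcast : ((E + E : ℕ) : ℝ) - 1 = ((2 * E - 1 : ℕ) : ℝ) := by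
    rw [Nat.cast_sub (by omega)]; push_cast; ring
  rw [hcast] at h2
  calc ∑ m ∈ Finset.Ico B₃ N, 1 / ((m : ℝ) ^ E) ^ 2 = ∑ m ∈ Finset.Ico B₃ N, (1 / (m : ℝ) ^ E) ^ 2 := by
        refine Finset.sum_congr rfl fun m _ ↦ by rw [div_pow, one_pow]
    _ ≤ ∑' k : ℕ, 1 / ((B₃ : ℝ) + k) ^ (E + E) := h
    _ ≤ _ := h2

end Far

/-! ## Quadratic-form bookkeeping -/

section Algebra

/-- `Σ_iΣ_{i'} x_ix_{i'}·Σ_jΣ_{j'} Z_{jj'}v_j(i)v_{j'}(i') = Σ_jΣ_{j'} Z_{jj'}(v_j·x)(v_{j'}·x)`. -/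
theorem sum_sum_mul_gram_eq {B D : ℕ} (Z : Fin D → Fin D → ℝ) (v : Fin D → Fin B → ℝ) (x : Fin B → ℝ) :
    ∑ i, ∑ i', x i * x i' * (∑ j, ∑ j', Z j j' * v j i * v j' i')
      = ∑ j, ∑ j', Z j j' * (∑ i, v j i * x i) * (∑ i, v j' i * x i) := by
  have hR : ∀ j j', Z j j' * (∑ i, v j i * x i) * (∑ i, v j' i * x i)
      = ∑ i, ∑ i', x i * x i' * (Z j j' * v j i * v j' i') := by
    intro j j'
    rw [mul_assoc, Finset.sum_mul_sum, Finset.mul_sum]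
    refine Finset.sum_congr rfl fun i _ ↦ ?_
    rw [Finset.mul_sum]
    refine Finset.sum_congr rfl fun i' _ ↦ by ring
  calc ∑ i, ∑ i', x i * x i' * (∑ j, ∑ j', Z j j' * v j i * v j' i')
      = ∑ i, ∑ i', ∑ j, ∑ j', x i * x i' * (Z j j' * v j i * v j' i') := by
        refine Finset.sum_congr rfl fun i _ ↦ Finset.sum_congr rfl fun i' _ ↦ ?_
        rw [Finset.mul_sum]
        refine Finset.sum_congr rfl fun j _ ↦ ?_
        rw [Finset.mul_sum]
    _ = ∑ i, ∑ j, ∑ i', ∑ j', x i * x i' * (Z j j' * v j i * v j' i') :=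
        Finset.sum_congr rfl fun i _ ↦ Finset.sum_comm
    _ = ∑ j, ∑ i, ∑ i', ∑ j', x i * x i' * (Z j j' * v j i * v j' i') := Finset.sum_comm
    _ = ∑ j, ∑ i, ∑ j', ∑ i', x i * x i' * (Z j j' * v j i * v j' i') :=
        Finset.sum_congr rfl fun j _ ↦ Finset.sum_congr rfl fun i _ ↦ Finset.sum_comm
    _ = ∑ j, ∑ j', ∑ i, ∑ i', x i * x i' * (Z j j' * v j i * v j' i') :=
        Finset.sum_congr rfl fun j _ ↦ Finset.sum_comm
    _ = _ := Finset.sum_congr rfl fun j _ ↦ Finset.sum_congr rfl fun j' _ ↦ (hR j j').symm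

/-- The Hankel quadratic form with a diagonal correction: `Σ_jΣ_{j'} (Z_{jj'} + δ_{jj'}G_j)α_jα_{j'} = Σ Z αα' + Σ_j G_j α_j²`. -/
theorem sum_sum_add_ite_mul_eq {D : ℕ} (Z : Fin D → Fin D → ℝ) (G α : Fin D → ℝ) :
    ∑ j, ∑ j', (Z j j' + if j = j' then G j else 0) * α j * α j'
      = (∑ j, ∑ j', α j * α j' * Z j j') + ∑ j, α j ^ 2 * G j := by
  rw [← Finset.sum_add_distrib]
  refine Finset.sum_congr rfl fun j _ ↦ ?_
  have : ∀ j', (Z j j' + if j = j' then G j else 0) * α j * α j'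
      = α j * α j' * Z j j' + (if j = j' then α j ^ 2 * G j else 0) := by
    intro j'
    split_ifs with h
    · subst h; ring
    · ring
  rw [Finset.sum_congr rfl fun j' _ ↦ this j', Finset.sum_add_distrib, Finset.sum_ite_eq]
  simp

/-- `Σ_iΣ_{i'} x_ix_{i'}(pA_{ii'} + qB_{ii'} + δ_{ii'}s c_i) = pΣΣxx'A + qΣΣxx'B + sΣ_i c_i x_i²`. -/
theorem sum_sum_mul_add3_eq {B : ℕ} (p q s : ℝ) (A Bm : Fin B → Fin B → ℝ) (c x : Fin B → ℝ) :
    ∑ i, ∑ i', x i * x i' * (p * A i i' + q * Bm i i' + if i = i' then s * c i else 0)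
      = p * ∑ i, ∑ i', x i * x i' * A i i' + q * ∑ i, ∑ i', x i * x i' * Bm i i' + s * ∑ i, c i * x i ^ 2 := by
  have : ∀ i i', x i * x i' * (p * A i i' + q * Bm i i' + if i = i' then s * c i else 0)
      = p * (x i * x i' * A i i') + q * (x i * x i' * Bm i i') + x i * x i' * (if i = i' then s * c i else 0) := by
    intro i i'; ring
  simp only [this, Finset.sum_add_distrib, ← Finset.mul_sum]
  congr 1
  rw [Finset.mul_sum]
  refine Finset.sum_congr rfl fun i _ ↦ ?_
  simp only [mul_ite, mul_zero, Finset.sum_ite_eq, Finset.mem_univ, if_true]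
  ring

end Algebra

end Summit.RiemannHypothesis.RiemannHypothesis.Theorems.WeilFormatC

end
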